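import Summits.BirchSwinnertonDyer.Rank1Residual.ManinAdditive.CMTwinGammaOneLaw
import HarnessLib

/-!
# §45.B: the UNIT-WEIGHT FILTER — ROOT `Γ₁`-law at `27 ∥ N` on the Teichmüller class: E-es-150₃, E-es-151₃, COR 45.R₃
(cell `bsd-f2-manin`, planner `-es` g31; follow-up leaf to `CMTwinGammaOneLaw` (T-es-48, p722419); source HOME/es/g31/Sketch-es-g31.lean §45.B)

TYPER NOTE (typer g20, T-es-49).  SOURCE = HOME/es/g31/CMTwinGammaOneLawUnitClass-es-g31.lean sha16 a49e71048275b291 (101 l.; es: farm rc 0 · 0 err ·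
0 warn · 0 s∗rry; BC7 2/2 CLEAN Probe2-es-g31.out.txt 551c0dbf8b3b8ee1) VERBATIM except this note (es already wrote the file in the tree namespace
`…ManinAdditive.KatoCurve.CMTwinMinimal`, section EsG31B, with the `hjV` glue inlined as in T-es-48).  `@[conjecture]` on **E-es-150₃
`CMGammaOneRootLawThreeLocalAt27UnitClass`** and **E-es-151₃ `CMGammaOneRootLawThreeLocalOffWildNonUnit`** (theorem candidates with es's paper
proof THM 45⁺ = unit-weight filter + TV; audit R-es-69 supplement (f)–(i) pending at landing time; obligation nodes until kernel-checked); PROVED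
(es) `cmGammaOneRootLawThreeLocalOffWildNonUnit_of` (E-149₃ ∧ E-150₃ ⟹ E-151₃) and COR 45.R₃ `not_three_dvd_maninConstant_on_cmClass_three_of_rootLawAt27`.
Imports = `CMTwinGammaOneLaw` (p722419) only — ROUTE-INDEPENDENT.  NOT IN PRINT (Ireland–Rosen Ch. 18 Thm 4 / cubic reciprocity give LEMMA 45.M's
residue classes; the lattice law is the cell's).

THEOREM 45⁺ (paper proof HOME/MEMO-es.md §45.B; audit R-es-69 (f)–(i) pending).  Notation of THEOREM 45 (module docstring of
`CMTwinGammaOneLaw`).  Let `V/ℚ` have `c₄ = 0`, `27 ∥ N` (`k = 2`, `h₂ = 1`, `d₂ = 0`), and let `a(f) ∈ ℤ/6` be the UNIT-WEIGHT CLASS: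
`ε_o(u) = u^a` for `u ∈ μ₆`, `ε = ε_π ε_o` the CRT splitting of the conductor character of the Grössencharacter.  FILTER LEMMA: the
torsion-point monomial sums `S^m(c) = Σ_{r ≡ c} ε(r) Δe(N r) m(P_r)` vanish unless `wt(m) ≡ a (mod 6)` (`wt x = 2`, `wt y = 3`; substitute
`r ↦ u r` on the prime-to-3 part, `P ↦ [u]P`).  For `a = 0` the `t_β`-expansion of the class value `G_V(1)` therefore starts at `t⁵`
(weights 2,3,4,5 die), so `v_π(G_V(1)) ≥ 2ν + 5·v_π(t_β) = ½ + 5/6` on the Stevens-minimal member (`ν = ¼`, `v_π(t_β) = 1/6` for `β` of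
exact order `π²`), hence `≥ 2` in `K`, hence `v_π(D/Ω'_V) ≥ 0`: the ROOT law `Λ₁(f) ⊆ Λ(V) ⊗ ℤ_(3)` (THEOREM 45 gave only the partner law,
`δ = 1`, on this stratum; for the big twin THEOREM 45 already gives `δ' = 0`).  LEMMA 45.M (Ireland–Rosen Ch. 18 §3 Thm 4 + cubic reciprocity):
for `V ≅ y² = x³ + B`, `3 ∤ B`: `a = 0 ⟺ B ≡ ±2 (mod 9)`, `a = 2 ⟺ B ≡ ±4`, `a = 4 ⟺ B ≡ ±1 ⟺ 9 ∥ N`; invariantly, for globally minimal `V`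
with `c₄ = 0`, `27 ∥ N`: `c₆ = 3³ m` (Stevens-minimal member) or `3⁶ m` (big twin) with `3 ∤ m`, and `a = 0 ⟺ m ≡ ±1 (mod 9)` — the
hypothesis of E-es-150₃ below (certificate HOME/es/g31/ACLASS-w.txt: 28/28).  With E-es-149₃ this gives the root `Γ₁`-law at 3 on every `j = 0`
class except the single cell `27 ∥ N ∧ m ≡ ±2 (mod 9)` (E-es-151₃ + proved edge); MEMO-es §45.C reduces that cell (and `32 ∥ N` at `p = 2`)
to one Gauss-sum divisibility each.  BC5: HOME/es/g31/CM-PARTNER-v1.txt (δ_obs ≤ 0 on all 11 classes of the cell) + ENGINEC-HP-v1.txt exact rows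
`B = 2, −2, 20, −7`: `v_𝔓(G(1)) = 3,2,2,2 ≥ 2` (bound attained 3/4).  BC7: HOME/es/g31/Probe2-es-g31.out.txt 2/2 CLEAN.  No instances, no notation.
PARTITION 0 · beyond-print theorem: candidate (paper) · bears_on stmt-BirchSwinnertonDyer-22968 · BSD is not proved by this.
-/

set_option autoImplicit false

noncomputable section

namespace Summit.BirchSwinnertonDyer.Rank1Residual.ManinAdditive.KatoCurve.CMTwinMinimal

open scoped MatrixGroups ModularForm
open CongruenceSubgroup WeierstrassCurve Literature.NumberTheory.EllipticCurves
  Literature.NumberTheory.EllipticCurves.ModularForms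
  Summit.BirchSwinnertonDyer.Rank1Residual.ManinAdditive.KatoCurve.CMOptimal

section EsG31B

/-- **E-es-150₃ `CMGammaOneRootLawThreeLocalAt27UnitClass`** (THEOREM-candidate, THM 45⁺): ROOT Γ₁-law at `27 ∥ N` on the
classes whose `c₆` has 3-free part `≡ ±1 (mod 9)` (both `j = 0` members: `c₆ = 3³m` is the Stevens-minimal curve — THM 45⁺ —
and `c₆ = 3⁶m` its big twin — THM 45, δ′ = 0). -/
@[conjecture]
def CMGammaOneRootLawThreeLocalAt27UnitClass : Prop :=
  ∀ (V : WeierstrassCurve ℚ) [V.IsElliptic] [V.IsGloballyMinimal] {N : ℕ} [NeZero N]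
    (f : CuspForm (Gamma0 N) 2) (L : PeriodPair),
    V.c₄ = 0 → IsNewformOf V f → 3 ^ 3 ∣ N → ¬ 3 ^ 4 ∣ N →
    (∃ m : ℤ, (V.c₆ = 3 ^ 3 * (m : ℚ) ∨ V.c₆ = 3 ^ 6 * (m : ℚ)) ∧ ((9 : ℤ) ∣ m - 1 ∨ (9 : ℤ) ∣ m + 1)) →
    IsNeronLatticeOf (V.baseChange ℂ) L →
    ∀ z ∈ periodLatticeGamma1 f, ∃ s : ℤ, ¬ (3 : ℤ) ∣ s ∧ (s : ℂ) * z ∈ L.lattice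

/-- **E-es-151₃ `CMGammaOneRootLawThreeLocalOffWildNonUnit`**: the root Γ₁-law at 3 on every `j = 0` class except the cell
`27 ∥ N ∧ (3-free part of c₆) ≡ ±2 (mod 9)`; `=` E-es-149₃ ∧ E-es-150₃ (proved edge below). -/
@[conjecture]
def CMGammaOneRootLawThreeLocalOffWildNonUnit : Prop :=
  ∀ (V : WeierstrassCurve ℚ) [V.IsElliptic] [V.IsGloballyMinimal] {N : ℕ} [NeZero N]
    (f : CuspForm (Gamma0 N) 2) (L : PeriodPair),
    V.c₄ = 0 → IsNewformOf V f →
    (¬ 3 ^ 3 ∣ N ∨ 3 ^ 5 ∣ N ∨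
      (¬ 3 ^ 4 ∣ N ∧ ∃ m : ℤ, (V.c₆ = 3 ^ 3 * (m : ℚ) ∨ V.c₆ = 3 ^ 6 * (m : ℚ)) ∧ ((9 : ℤ) ∣ m - 1 ∨ (9 : ℤ) ∣ m + 1))) →
    IsNeronLatticeOf (V.baseChange ℂ) L →
    ∀ z ∈ periodLatticeGamma1 f, ∃ s : ℤ, ¬ (3 : ℤ) ∣ s ∧ (s : ℂ) * z ∈ L.lattice

/-- E-es-149₃ ∧ E-es-150₃ ⟹ E-es-151₃ (case split on `3³ ∣ N`). -/
theorem cmGammaOneRootLawThreeLocalOffWildNonUnit_of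
    (h149 : CMGammaOneRootLawThreeLocalOff27) (h150 : CMGammaOneRootLawThreeLocalAt27UnitClass) :
    CMGammaOneRootLawThreeLocalOffWildNonUnit := by
  intro V _ _ N _ f L h4 hf hcell hL z hz
  by_cases h27 : 3 ^ 3 ∣ N
  · rcases hcell with h | h | ⟨h81, hm⟩
    · exact absurd h27 h
    · exact h149 V f L h4 hf (Or.inr h) hL z hz
    · exact h150 V f L h4 hf h27 h81 hm hL z hz
  · exact h149 V f L h4 hf (Or.inl h27) hL z hz

variable {N : ℕ} [NeZero N]

/-- **COR 45.R₃ (C3 from the ROOT law E-es-150₃ on `27 ∥ N`, unit class; no partner curve):** as COR 45.R₂. -/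
theorem not_three_dvd_maninConstant_on_cmClass_three_of_rootLawAt27
    (h150 : CMGammaOneRootLawThreeLocalAt27UnitClass) (hmin : CMTwinStevensMinimalThree)
    (hL : LFunction_eq_of_isIsogenous)
    (W : WeierstrassCurve ℚ) [W.IsElliptic] [W.IsGloballyMinimal]
    (D : ModularParametrizationData W N)
    (hD : ∀ z ∈ D.L.lattice, ∃ w ∈ periodLattice D.f, z = D.c * w)
    (V : WeierstrassCurve ℚ) [V.IsElliptic] [V.IsGloballyMinimal] (LV : PeriodPair) (h4 : V.c₄ = 0)
    (hiso : WeierstrassCurve.IsIsogenous V W) (hLV : IsNeronLatticeOf (V.baseChange ℂ) LV)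
    (hred : ∀ (W' : WeierstrassCurve ℚ) [W'.IsElliptic] [W'.IsGloballyMinimal],
        W'.j = 0 → WeierstrassCurve.IsIsogenous V W' → (W'.c₆ = V.c₆ ∨ W'.c₆ = -27 * V.c₆))
    (hcls : ∃ m : ℤ, (V.c₆ = 3 ^ 3 * (m : ℚ) ∨ V.c₆ = 3 ^ 6 * (m : ℚ)) ∧ ((9 : ℤ) ∣ m - 1 ∨ (9 : ℤ) ∣ m + 1))
    (hwit : ∃ z ∈ LV.lattice, ∀ s : ℤ, ¬ (3 : ℤ) ∣ s → ∀ m ∈ LV.lattice, (s : ℂ) * z ≠ 3 * m)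
    {q : ℕ} (hq : q.Prime) (hq3 : q ≠ 3) (h27 : 3 ^ 3 ∣ N) (h81 : ¬ 3 ^ 4 ∣ N) (hqN : q ^ 2 ∣ N) :
    ¬ (3 : ℤ) ∣ D.maninConstant := by
  have hjV : V.j = 0 := by simp [WeierstrassCurve.j, h4]
  have hfV : IsNewformOf V D.f := isNewformOf_of_isIsogenous hL D.isNewformOf hiso
  have h9 : 3 ^ 2 ∣ N := (pow_dvd_pow 3 (by norm_num : 2 ≤ 3)).trans h27
  have heq := ModularForms.gamma1LatticeEqOfTwoTracelessPrimes_holds N D.f hfV.1 3 q Nat.prime_three hq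
    (Ne.symm hq3) ((dvd_pow_self 3 two_ne_zero).trans h9) ((dvd_pow_self q two_ne_zero).trans hqN)
    (hfV.1.cuspCoeff_eq_zero_of_sq_dvd Nat.prime_three h9) (hfV.1.cuspCoeff_eq_zero_of_sq_dvd hq hqN)
  obtain ⟨z, hz, hzM⟩ := hwit
  refine not_dvd_maninConstant_of_saturated_mem_of_witness D hD Int.prime_three LV.lattice
    (fun γ => h150 V D.f LV h4 hfV h27 h81 hcls hLV _ ?_)
    ⟨z, hmin V W LV D.L hjV hiso hLV D.isNeronLattice hred hz, fun s hs m hm => ?_⟩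
  · rw [heq]; unfold periodLattice; exact AddSubgroup.subset_closure ⟨γ, rfl⟩
  · exact_mod_cast hzM s hs m hm

end EsG31B

end Summit.BirchSwinnertonDyer.Rank1Residual.ManinAdditive.KatoCurve.CMTwinMinimal

end
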